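import Mathlib
import Summits.AtomisticToContinuum.HydrodynamicLimit.Theorems.ImplosionDichotomyDenseExcursionCavityCentreWronskian
import Summits.AtomisticToContinuum.HydrodynamicLimit.Theorems.ImplosionDichotomyDenseExcursionSonicCavityResolventUnique

/-!
# Centre-regular solutions of the homogeneous resolvent equation form a line (theorem T3, uniqueness half)
# (crux `DenseExcursion`, line `sonic-cavity-renewal`, brick for stub `stub_cavityResolventCk`)

Helper file (`--supports stmt-AtomisticToContinuum-12586`, line lead a2, stub-worker E for `stub_cavityResolventCk`,
theorem T3 `centre_regular_branch` of its decomposition — the UNIQUENESS / STRUCTURE half). Registered helper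
`centre_regular_unique`: for a monatomic profile in the cavity tube, `Λ : ℂ` and `X ≥ 0`, two REGULAR pairs
(`IsRegularPair`) solving the HOMOGENEOUS resolvent equation `Λŵ = linW`, `Λŝ = linS` on `x ≤ −X`, the second one
non-trivial there, are proportional on `x ≤ −X`. Consequently (`centre_regular_affine`) every regular solution of the
sourced equation on `x ≤ −X` is a fixed particular regular solution plus a multiple of a fixed non-trivial regular
homogeneous one: the regular solutions at the centre form a ONE-parameter family (the content of the Fuchsian
structure at `R = eˣ → 0`, exponents `0` and `−3`, needed by the matching step T6), proved WITHOUT Fuchsian theory: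

* the Wronskian `w = ŵ₁ŝ₂ − ŵ₂ŝ₁` satisfies `w′ = (T/det)·w` (`wronskian_hasDerivAt`, file `…CavityCentreWronskian`) and
  `Re(T/det) ≤ −3` for `x ≤ −X₂(r, Re Λ)` (`three_mul_neg_det_le_re_T` + the tube's envelope and centre expansion,
  which give `|(eˣS)′| ≤ (11/5)e^{2x}`), so `e^{6x}|w|²` is non-increasing on `(−∞, −X₂]`;
* regularity gives `|w| ≤ 2C₁C₂e^{−2x}` (`realBound_centre_decay`), i.e. `e^{6x}|w|² ≤ 4C₁²C₂²e^{2x} → 0` at the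
  centre: so `w ≡ 0` on `x ≤ −X₂`;
* a non-trivial solution of the homogeneous system vanishes nowhere on `x < 0` and a solution vanishing at one point
  vanishes on `x ≤ −X` (`homogeneous_eq_zero_of_zero`), which turns `w(x₀) = 0`, `x₀ = −X₂ − 1`, into proportionality.

NOT here: EXISTENCE of a non-trivial regular homogeneous solution and of regular particular solutions (the existence
half of T3: the smooth Fuchsian branch at the centre). Sources: folklore (Abel's identity; Coddington–Levinson Ch. 3 §1).
-/

noncomputable section

open Set Filter
open scoped Topology ContDiff ComplexConjugate

namespace Summit.AtomisticToContinuum.HydrodynamicLimit.Theorems.SonicCavityRenewal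

open Summit.AtomisticToContinuum.HydrodynamicLimit.Theorems.R2OneModeTwoConditions

/-- **Registered helper `centre_regular_unique` (T3, uniqueness half): CENTRE-REGULAR SOLUTIONS OF THE HOMOGENEOUS
RESOLVENT EQUATION ARE PROPORTIONAL.** For a monatomic profile in the cavity tube, `Λ : ℂ`, `X ≥ 0` and two regular
pairs solving `Λŵ = linW`, `Λŝ = linS` on `x ≤ −X`, the second non-trivial there, there is `a : ℂ` with
`(ŵ₁, ŝ₁) = a·(ŵ₂, ŝ₂)` on `x ≤ −X` (Wronskian monotone at the centre vs. the decay of regular pairs; see the module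
docstring). [folklore] -/
theorem centre_regular_unique : ∀ (r : ℝ) (W S : ℝ → ℝ), IsMonatomicProfile r W S → CavityTube r W S → ∀ (Λ : ℂ) (X : ℝ), 0 ≤ X → ∀ (ŵ₁ ŝ₁ ŵ₂ ŝ₂ : ℝ → ℂ), IsRegularPair ŵ₁ ŝ₁ → IsRegularPair ŵ₂ ŝ₂ → (∀ x ∈ Set.Iic (-X), Λ * ŵ₁ x = linW r W S ŵ₁ ŝ₁ x ∧ Λ * ŝ₁ x = linS r W S ŵ₁ ŝ₁ x) → (∀ x ∈ Set.Iic (-X), Λ * ŵ₂ x = linW r W S ŵ₂ ŝ₂ x ∧ Λ * ŝ₂ x = linS r W S ŵ₂ ŝ₂ x) → (∃ x ∈ Set.Iic (-X), ŵ₂ x ≠ 0 ∨ ŝ₂ x ≠ 0) → ∃ a : ℂ, ∀ x ∈ Set.Iic (-X), ŵ₁ x = a * ŵ₂ x ∧ ŝ₁ x = a * ŝ₂ x := by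
  intro r W S hP hT Λ X hX ŵ₁ ŝ₁ ŵ₂ ŝ₂ hreg₁ hreg₂ hsol₁ hsol₂ hne
  obtain ⟨hr1, -, hW, hS, hSpos, -⟩ := hP
  obtain ⟨-, hsup, -, -, -, -, -, hWenv, hSenv, ⟨W₂, s₀, s₂, -, -, -, hs₂, hcentre⟩, -⟩ := hT
  have d₁ : Differentiable ℝ ŵ₁ := hreg₁.1.differentiable (by simp)
  have d₁' : Differentiable ℝ ŝ₁ := hreg₁.2.1.differentiable (by simp)
  have d₂ : Differentiable ℝ ŵ₂ := hreg₂.1.differentiable (by simp)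
  have d₂' : Differentiable ℝ ŝ₂ := hreg₂.2.1.differentiable (by simp)
  -- the system is regular on `x < 0`, with `det < 0`
  have hnc : ∀ x, x < 0 → W x - 1 + S x ≠ 0 ∧ W x - 1 - S x ≠ 0 := by
    intro x hx
    have h1 := hsup x hx
    have h2 := abs_le.1 (hWenv x (by linarith)).1
    have h3 := hSpos x
    exact ⟨(by linarith : 0 < W x - 1 + S x).ne', (by linarith : W x - 1 - S x < 0).ne⟩
  have hdet : ∀ x, x < 0 → (W x - 1) ^ 2 - S x ^ 2 < 0 := by
    intro x hx
    have h1 := hsup x hx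
    have h2 := abs_le.1 (hWenv x (by linarith)).1
    have h3 := hSpos x
    rw [sq_sub_sq]
    exact mul_neg_of_pos_of_neg (by linarith) (by linarith)
  -- decay of the regular pairs at the centre
  obtain ⟨C₁, hC₁0, hC₁⟩ := realBound_centre_decay ŵ₁ ŝ₁ hreg₁
  obtain ⟨C₂, hC₂0, hC₂⟩ := realBound_centre_decay ŵ₂ ŝ₂ hreg₂
  -- the far region `x ≤ -X₂`
  set K₁ : ℝ := 5 / 2 * (|Λ.re| + 1 + r) with hK₁
  have hK₁0 : 0 ≤ K₁ := by rw [hK₁]; have := abs_nonneg Λ.re; nlinarith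
  set X₂ : ℝ := max (max X 22) (2 * K₁) with hX₂
  have hX₂X : X ≤ X₂ := le_trans (le_max_left _ _) (le_max_left _ _)
  have hX₂22 : (22 : ℝ) ≤ X₂ := le_trans (le_max_right _ _) (le_max_left _ _)
  have hX₂K : 2 * K₁ ≤ X₂ := le_max_right _ _
  have hsmallexp : ∀ x, x ≤ -X₂ → Real.exp (2 * x) * (1 + 2 * X₂) ≤ 1 := by
    intro x hx
    have h1 : Real.exp (2 * x) ≤ Real.exp (-(2 * X₂)) := Real.exp_le_exp.2 (by linarith)
    have h2 : 2 * X₂ + 1 ≤ Real.exp (2 * X₂) := Real.add_one_le_exp _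
    have h3 : Real.exp (-(2 * X₂)) * Real.exp (2 * X₂) = 1 := by rw [← Real.exp_add]; simp
    have h4 : 0 < Real.exp (-(2 * X₂)) := Real.exp_pos _
    nlinarith [Real.exp_pos (2 * x)]
  -- the sign of `Re(T/det)` on `x ≤ -X₂`
  have hfar : ∀ x, x ≤ -X₂ →
      3 * (S x ^ 2 - (W x - 1) ^ 2) ≤ (W x - 1) * (2 * Λ.re - (deriv W x + 2 * W x - r) -
        (deriv W x / 3 + 2 * W x - r)) + 4 * S x * (deriv S x + 2 * S x) := by
    intro x hx
    have hx0 : x ≤ 0 := by linarith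
    have hx1 : x ≤ 1 := by linarith
    obtain ⟨hw, hw', -⟩ := hWenv x hx1
    obtain ⟨hs1, -, -, -⟩ := hSenv x hx1
    obtain ⟨-, -, -, -, hsd, -⟩ := hcentre x hx0
    have hprod : deriv (fun y => Real.exp y * S y) x = Real.exp x * S x + Real.exp x * deriv S x :=
      ((Real.hasDerivAt_exp x).mul (hS.differentiable (by simp) x).hasDerivAt).deriv
    have hsmall := hsmallexp x hx
    have he1 : Real.exp (2 * x) ≤ 1 := by rw [Real.exp_le_one_iff]; linarith
    have he4 : Real.exp (4 * x) ≤ Real.exp (2 * x) := Real.exp_le_exp.2 (by linarith)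
    refine three_mul_neg_det_le_re_T (Λ := Λ) hr1.le hw hw' hs1 ?_ ?_
    · -- `|(eˣS)′| ≤ (2|s₂| + 2 e^{2x}) e^{2x} ≤ (11/5) e^{2x} ≤ (11/5)/(1 + 2X₂) ≤ 1/20`
      rw [← hprod]
      have h1 : |deriv (fun y => Real.exp y * S y) x| ≤ 2 * |s₂| * Real.exp (2 * x) + 2 * Real.exp (4 * x) := by
        have := abs_le.1 hsd
        rw [abs_le]
        constructor <;> nlinarith [abs_nonneg s₂, le_abs_self s₂, neg_abs_le s₂, Real.exp_pos (2 * x),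
          Real.exp_pos (4 * x)]
      have h2 : 2 * |s₂| * Real.exp (2 * x) + 2 * Real.exp (4 * x) ≤ 11 / 5 * Real.exp (2 * x) := by
        nlinarith [Real.exp_pos (2 * x)]
      nlinarith [Real.exp_pos (2 * x)]
    · nlinarith [Real.exp_pos (2 * x)]
  -- the Wronskian and its derivative
  obtain ⟨q, hq⟩ : ∃ q : ℝ → ℂ, q = fun x =>
      (((W x - 1 : ℝ) : ℂ) * (2 * Λ - ((deriv W x + 2 * W x - r : ℝ) : ℂ) - ((deriv W x / 3 + 2 * W x - r : ℝ) : ℂ)) +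
          ((3 * S x : ℝ) : ℂ) * ((deriv S x + 2 * S x : ℝ) : ℂ) +
          ((S x / 3 : ℝ) : ℂ) * ((3 * deriv S x + 6 * S x : ℝ) : ℂ)) /
        (((W x - 1) ^ 2 - S x ^ 2 : ℝ) : ℂ) := ⟨_, rfl⟩
  set w : ℝ → ℂ := fun y => ŵ₁ y * ŝ₂ y - ŵ₂ y * ŝ₁ y with hw
  have hwd : ∀ x, x ≤ -X₂ → HasDerivAt w (q x * w x) x := by
    intro x hx
    have hxX : x ∈ Iic (-X) := show x ≤ -X by linarith
    have h := wronskian_hasDerivAt (d₁ x) (d₁' x) (d₂ x) (d₂' x) (hsol₁ x hxX).1 (hsol₁ x hxX).2 (hsol₂ x hxX).1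
      (hsol₂ x hxX).2 (hdet x (by linarith)).ne
    rw [hq]
    exact h
  have hqre : ∀ x, x ≤ -X₂ → (q x).re ≤ -3 := by
    intro x hx
    have hd := hdet x (by linarith)
    rw [hq]
    simp only
    rw [Complex.div_ofReal_re, re_T_eq, div_le_iff_of_neg hd]
    linarith [hfar x hx]
  -- `φ = e^{6x}|w|²` is non-increasing on `(−∞, −X₂]`
  set φ : ℝ → ℝ := fun y => Real.exp (6 * y) * ‖w y‖ ^ 2 with hφ
  have hφd : ∀ x, x ≤ -X₂ → HasDerivAt φ (Real.exp (6 * x) * ‖w x‖ ^ 2 * (6 + 2 * (q x).re)) x := by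
    intro x hx
    have h1 : HasDerivAt (fun y => Real.exp (6 * y)) (Real.exp (6 * x) * 6) x := by
      simpa using ((hasDerivAt_id x).const_mul 6).exp
    have h2 := (hwd x hx).norm_sq
    have hinner : @inner ℝ ℂ _ (w x) (q x * w x) = (q x).re * ‖w x‖ ^ 2 := by
      rw [Complex.inner, mul_assoc, Complex.mul_conj, Complex.normSq_eq_norm_sq, Complex.re_mul_ofReal]
    have h3 : HasDerivAt (fun y => Real.exp (6 * y) * ‖w y‖ ^ 2) _ x := h1.mul h2
    convert h3 using 1
    rw [hinner]
    ring
  have hφanti : AntitoneOn φ (Iic (-X₂)) := by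
    refine antitoneOn_of_deriv_nonpos (convex_Iic _) ?_ ?_ ?_
    · exact fun x hx => (hφd x hx).continuousAt.continuousWithinAt
    · rw [interior_Iic]
      exact fun x hx => (hφd x (le_of_lt hx)).differentiableAt.differentiableWithinAt
    · rw [interior_Iic]
      intro x hx
      rw [(hφd x (le_of_lt hx)).deriv]
      have h := hqre x (le_of_lt hx)
      have : 6 + 2 * (q x).re ≤ 0 := by linarith
      exact mul_nonpos_of_nonneg_of_nonpos (by positivity) this
  -- `φ ≤ 4C₁²C₂² e^{2x}` on `x ≤ 0`
  have hφb : ∀ x, x ≤ 0 → φ x ≤ 4 * C₁ ^ 2 * C₂ ^ 2 * Real.exp (2 * x) := by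
    intro x hx
    obtain ⟨a1, b1⟩ := hC₁ x hx
    obtain ⟨a2, b2⟩ := hC₂ x hx
    have hwle : ‖w x‖ ≤ 2 * C₁ * C₂ * Real.exp (-x) ^ 2 := by
      calc ‖w x‖ ≤ ‖ŵ₁ x * ŝ₂ x‖ + ‖ŵ₂ x * ŝ₁ x‖ := norm_sub_le _ _
        _ = ‖ŵ₁ x‖ * ‖ŝ₂ x‖ + ‖ŵ₂ x‖ * ‖ŝ₁ x‖ := by rw [norm_mul, norm_mul]
        _ ≤ C₁ * Real.exp (-x) * (C₂ * Real.exp (-x)) + C₂ * Real.exp (-x) * (C₁ * Real.exp (-x)) :=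
            add_le_add (mul_le_mul a1 b2 (norm_nonneg _) (by positivity))
              (mul_le_mul a2 b1 (norm_nonneg _) (by positivity))
        _ = 2 * C₁ * C₂ * Real.exp (-x) ^ 2 := by ring
    have hsq := pow_le_pow_left₀ (norm_nonneg _) hwle 2
    have hexp : Real.exp (6 * x) * (2 * C₁ * C₂ * Real.exp (-x) ^ 2) ^ 2 = 4 * C₁ ^ 2 * C₂ ^ 2 * Real.exp (2 * x) := by
      have : Real.exp (6 * x) * (Real.exp (-x) ^ 2) ^ 2 = Real.exp (2 * x) := by
        rw [← Real.exp_nat_mul, ← Real.exp_nat_mul, ← Real.exp_add]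
        congr 1; push_cast; ring
      calc Real.exp (6 * x) * (2 * C₁ * C₂ * Real.exp (-x) ^ 2) ^ 2
          = 4 * C₁ ^ 2 * C₂ ^ 2 * (Real.exp (6 * x) * (Real.exp (-x) ^ 2) ^ 2) := by ring
        _ = _ := by rw [this]
    calc φ x = Real.exp (6 * x) * ‖w x‖ ^ 2 := rfl
      _ ≤ Real.exp (6 * x) * (2 * C₁ * C₂ * Real.exp (-x) ^ 2) ^ 2 :=
          mul_le_mul_of_nonneg_left hsq (Real.exp_pos _).le
      _ = _ := hexp
  -- hence `w = 0` on `x ≤ -X₂`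
  have hw0 : ∀ y, y ≤ -X₂ → w y = 0 := by
    intro y hy
    have hφ0 : φ y ≤ 0 := by
      by_contra hpos'
      have hpos : 0 < φ y := not_le.1 hpos'
      have hlim : Tendsto (fun x : ℝ => 4 * C₁ ^ 2 * C₂ ^ 2 * Real.exp (2 * x)) atBot (𝓝 0) := by
        have h := (Real.tendsto_exp_atBot.comp (tendsto_id.const_mul_atBot (by norm_num : (0 : ℝ) < 2))).const_mul
          (4 * C₁ ^ 2 * C₂ ^ 2)
        rw [mul_zero] at h
        exact h
      obtain ⟨x₁, hx₁⟩ := (hlim.eventually (gt_mem_nhds hpos)).exists_forall_of_atBot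
      set x := min x₁ y with hxdef
      have hxy : x ≤ y := min_le_right _ _
      have h1 : φ y ≤ φ x := hφanti (show x ≤ -X₂ by linarith) hy hxy
      have h2 : φ x ≤ 4 * C₁ ^ 2 * C₂ ^ 2 * Real.exp (2 * x) := hφb x (by linarith)
      have h3 := hx₁ x (min_le_left _ _)
      linarith
    have hφnn : 0 ≤ φ y := by positivity
    have hφy : φ y = 0 := le_antisymm hφ0 hφnn
    have : ‖w y‖ ^ 2 = 0 := by
      have h := mul_eq_zero.1 hφy
      rcases h with h | h
      · exact absurd h (Real.exp_pos _).ne'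
      · exact h
    exact norm_eq_zero.1 (pow_eq_zero_iff (n := 2) (by norm_num) |>.1 this)
  -- the point `x₀ = -X₂ - 1` and the non-vanishing of `(ŵ₂, ŝ₂)` there
  set x₀ : ℝ := -X₂ - 1 with hx₀
  have hx₀X : x₀ < -X := by rw [hx₀]; linarith
  have hv₂ : ŵ₂ x₀ ≠ 0 ∨ ŝ₂ x₀ ≠ 0 := by
    by_contra h
    have hz := homogeneous_eq_zero_of_zero hW hS hnc hX hx₀X d₂ d₂' hsol₂ (by_contra fun h' => h (Or.inl h'))
      (by_contra fun h' => h (Or.inr h'))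
    obtain ⟨x', hx', hne'⟩ := hne
    rcases hne' with h1 | h1
    · exact h1 (hz x' hx').1
    · exact h1 (hz x' hx').2
  have hwx₀ : ŵ₁ x₀ * ŝ₂ x₀ - ŵ₂ x₀ * ŝ₁ x₀ = 0 := hw0 x₀ (by rw [hx₀]; linarith)
  -- the proportionality constant
  obtain ⟨a, ha₁, ha₂⟩ : ∃ a : ℂ, ŵ₁ x₀ = a * ŵ₂ x₀ ∧ ŝ₁ x₀ = a * ŝ₂ x₀ := by
    rcases hv₂ with h | h
    · refine ⟨ŵ₁ x₀ / ŵ₂ x₀, by field_simp, ?_⟩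
      field_simp
      linear_combination -hwx₀
    · refine ⟨ŝ₁ x₀ / ŝ₂ x₀, ?_, by field_simp⟩
      field_simp
      linear_combination hwx₀
  -- the difference `(ŵ₁ − aŵ₂, ŝ₁ − aŝ₂)` solves the homogeneous equations and vanishes at `x₀`
  refine ⟨a, fun x hx => ?_⟩
  have hdiff := homogeneous_eq_zero_of_zero (r := r) (Λ := Λ) hW hS hnc hX hx₀X (ŵ := fun y => ŵ₁ y - a * ŵ₂ y)
    (ŝ := fun y => ŝ₁ y - a * ŝ₂ y) (d₁.sub (d₂.const_mul a)) (d₁'.sub (d₂'.const_mul a)) (fun y hy => ?_)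
    (by rw [ha₁, sub_self]) (by rw [ha₂, sub_self]) x hx
  · obtain ⟨h1, h2⟩ := hdiff
    exact ⟨by simpa [sub_eq_zero] using h1, by simpa [sub_eq_zero] using h2⟩
  · obtain ⟨h1, h2⟩ := hsol₁ y hy
    obtain ⟨h3, h4⟩ := hsol₂ y hy
    obtain ⟨h5, h6⟩ := lin_const_mul (r := r) (W := W) (S := S) a (d₂ y) (d₂' y)
    have e1 := linW_sub (r := r) (W := W) (S := S) (d₂.const_mul a) (d₂'.const_mul a) d₁ d₁' y
    have e2 := linS_sub (r := r) (W := W) (S := S) (d₂.const_mul a) (d₂'.const_mul a) d₁ d₁' y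
    rw [e1, e2, h5, h6]
    constructor
    · linear_combination h1 - a * h3
    · linear_combination h2 - a * h4

/-- **COROLLARY `centre_regular_affine` (T3, structure of regular solutions at the centre): REGULAR SOLUTIONS OF THE
SOURCED RESOLVENT EQUATION ON `x ≤ −X` = A PARTICULAR ONE + A MULTIPLE OF A NON-TRIVIAL REGULAR HOMOGENEOUS ONE.**
Given a regular pair `(ŵc, ŝc)` solving the homogeneous equations on `x ≤ −X` and non-trivial there, and two regular
pairs `(ŵp, ŝp)`, `(ŵ, ŝ)` solving the equation with the same source `(f, g)` on `x ≤ −X`, there is `a : ℂ` with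
`(ŵ, ŝ) = (ŵp, ŝp) + a·(ŵc, ŝc)` on `x ≤ −X` (`centre_regular_unique` for the difference). [folklore] -/
theorem centre_regular_affine {r : ℝ} {W S : ℝ → ℝ} (hP : IsMonatomicProfile r W S) (hT : CavityTube r W S) (Λ : ℂ)
    {X : ℝ} (hX : 0 ≤ X) {f g ŵc ŝc ŵp ŝp ŵ ŝ : ℝ → ℂ} (hc : IsRegularPair ŵc ŝc) (hp : IsRegularPair ŵp ŝp)
    (h : IsRegularPair ŵ ŝ)
    (hsolc : ∀ x ∈ Iic (-X), Λ * ŵc x = linW r W S ŵc ŝc x ∧ Λ * ŝc x = linS r W S ŵc ŝc x)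
    (hnec : ∃ x ∈ Iic (-X), ŵc x ≠ 0 ∨ ŝc x ≠ 0)
    (hsolp : ∀ x ∈ Iic (-X), Λ * ŵp x - linW r W S ŵp ŝp x = f x ∧ Λ * ŝp x - linS r W S ŵp ŝp x = g x)
    (hsol : ∀ x ∈ Iic (-X), Λ * ŵ x - linW r W S ŵ ŝ x = f x ∧ Λ * ŝ x - linS r W S ŵ ŝ x = g x) :
    ∃ a : ℂ, ∀ x ∈ Iic (-X), ŵ x = ŵp x + a * ŵc x ∧ ŝ x = ŝp x + a * ŝc x := by
  have dp : Differentiable ℝ ŵp := hp.1.differentiable (by simp)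
  have dp' : Differentiable ℝ ŝp := hp.2.1.differentiable (by simp)
  have d : Differentiable ℝ ŵ := h.1.differentiable (by simp)
  have d' : Differentiable ℝ ŝ := h.2.1.differentiable (by simp)
  have hsold : ∀ x ∈ Iic (-X), Λ * (ŵ x - ŵp x) = linW r W S (fun y => ŵ y - ŵp y) (fun y => ŝ y - ŝp y) x ∧
      Λ * (ŝ x - ŝp x) = linS r W S (fun y => ŵ y - ŵp y) (fun y => ŝ y - ŝp y) x := by
    intro x hx
    obtain ⟨h1, h2⟩ := hsolp x hx
    obtain ⟨h3, h4⟩ := hsol x hx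
    rw [linW_sub dp dp' d d' x, linS_sub dp dp' d d' x]
    exact ⟨by linear_combination h3 - h1, by linear_combination h4 - h2⟩
  obtain ⟨a, ha⟩ := centre_regular_unique r W S hP hT Λ X hX (fun y => ŵ y - ŵp y) (fun y => ŝ y - ŝp y) ŵc ŝc
    (isRegularPair_sub hp h) hc hsold hsolc hnec
  refine ⟨a, fun x hx => ?_⟩
  obtain ⟨h1, h2⟩ := ha x hx
  exact ⟨by linear_combination h1, by linear_combination h2⟩

end Summit.AtomisticToContinuum.HydrodynamicLimit.Theorems.SonicCavityRenewal

end
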